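import Mathlib
import HarnessLib
import Summits.HubbardSuperconductivity.HubbardSuperconductivity.Theses.EnslavedA1g
import Summits.HubbardSuperconductivity.HubbardSuperconductivity.Theorems.EnslavedA1gPairChemicalPotentialWindowLemmas
import Summits.HubbardSuperconductivity.HubbardSuperconductivity.Theorems.ThermalWedgeTwTipContinuationEdgeOrderPairAlgebra
import Literature.MathematicalPhysics.QuantumLattice.HubbardSzSectorLadder
import Literature.MathematicalPhysics.QuantumLattice.HubbardHubbardModelEtaODLROProofs

/-!
# Route `EnslavedA1g`, support `PairChemicalPotentialWindow` (item `stmt-HubbardSuperconductivity-0939`)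

THE PAIR CHEMICAL-POTENTIAL WINDOW of the repulsive Hubbard torus: for `U ≥ 0`, even `L > 2`,
even `N` with `N + 2 ≤ L²` and `E(N, 0) = minEnergyOn (hubbardTorus 2 L 1 U) (szSector N 0)`,

  `0 ≤ U - (E(N+2,0) - E(N,0)) ≤ U + 8`  (`pairChemicalPotentialWindow_proof`).

* Upper sector bound `E(N+2,0) ≤ E(N,0) + U` (`minEnergyOn_pairAdded_le`): Yang's raising operator
  `η† = etaRaise torusStagger` maps a ground state `ψ` of the sector `(n,n)` (`n = N/2`) to the sector
  `(n+1,n+1)` (grading `shifts_etaRaise`), `[H, η†] = U η†` on the torus of even side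
  (`hamiltonian_commutator_etaRaise` + `torusStagger_eq_neg_of_adj_holds`), and `η†ψ ≠ 0` for
  `N < L²` because `‖η†ψ‖² = ‖ηψ‖² + (L² - N)‖ψ‖²` (`EtaPairingODLRO.etaLower_mulVec_etaRaise_mulVec`);
  the variational principle in the sector `(n+1,n+1)` finishes.
* Lower bound `E(N,0) ≤ E(N+2,0) + 8` (`minEnergyOn_pairRemoved_le`): remove one `↓` and then one
  `↑` electron from sector ground states, passing through the sector `(n+1,n) = szSector (2n+1) (1/2)`.
  For `H φ = E φ` and a spin `τ`, the "Euler identity" `Σ_z c†_{zτ} [H, c_{zτ}] = -T_τ - U Σ_z n_{zτ̄} n_{zτ}`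
  gives, on any graph of maximal degree `≤ Δ` and for `U ≥ 0`,
  `Σ_z Re⟨c_{zτ}φ, H c_{zτ}φ⟩ ≤ (E + Δ|t|) Σ_z ‖c_{zτ}φ‖²` (`sum_re_expect_annihilation_le`), and
  `Σ_z ‖c_{zτ}φ‖² = N_τ ‖φ‖² > 0`; the homogeneous variational principle in the lower sector gives
  `E(lower) ≤ E + Δ|t|` (`le_of_removal_bound`), used twice with `Δ = 4`, `t = 1`.

Sources: C. N. Yang, PRL 63 (1989) 2144 (η pairing, `[H, η†] = U η†`); E. H. Lieb, PRL 62 (1989)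
1201 (sectors `(N↑, N↓)`); H. Tasaki, *Physics and Mathematics of Quantum Many-Body Systems*
(2020) §2.1 (variational principle). The computation is folklore; no definition is introduced.
-/

noncomputable section

-- the mandated namespace `Summit.<Summit>.<Problem>.Theorems` repeats `HubbardSuperconductivity`
-- (single-problem summit, D-0017), which the `dupNamespace` linter flags on every declaration
set_option linter.dupNamespace false

namespace Summit.HubbardSuperconductivity.HubbardSuperconductivity.Theorems.EnslavedA1g

open Matrix
open Literature.Probability.LatticeModels Literature.MathematicalPhysics.QuantumLattice
open Literature.MathematicalPhysics.QuantumLattice.EigenvalueContinuation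
  (re_star_dotProduct_self_nonneg re_star_dotProduct_self_pos)
open Summit.HubbardSuperconductivity.TwTipContinuation.IsogapTransport
  (sum_numberOp_up_mulVec sum_numberOp_down_mulVec)
open Summit.HubbardSuperconductivity.HubbardSuperconductivity.Theses.EnslavedA1g
open scoped ComplexOrder

/-! ### The one-particle removal bound -/

section Removal

variable {Λ : Type*} [LinearOrder Λ] [Fintype Λ] (G : SimpleGraph Λ) [DecidableRel G.Adj]

/-- **Euler-identity bound.** On a graph of maximal degree `≤ Δ`, for `U ≥ 0` and an eigenvector
`H φ = E φ` of the Hubbard Hamiltonian: `Σ_z Re ⟨c_{zτ}φ, H c_{zτ}φ⟩ ≤ (E + Δ|t|) Σ_z ‖c_{zτ}φ‖²`.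
Indeed `⟨c_zφ, H c_zφ⟩ = E‖c_zφ‖² + ⟨c_zφ, [H, c_z]φ⟩`, the interaction part of the commutator
contributes `-U ‖c_{zτ̄} c_{zτ} φ‖² ≤ 0`, and the hopping part `t Σ_{y∼z} Re⟨c_zφ, c_yφ⟩` is at most
`|t| Σ_{y∼z} (‖c_zφ‖² + ‖c_yφ‖²)/2`. Tasaki (2020) §2.1; folklore. [folklore] -/
theorem sum_re_expect_annihilation_le {Δ : ℕ}
    (hΔ : ∀ x : Λ, (Finset.univ.filter fun y => G.Adj x y).card ≤ Δ) (t : ℝ) {U : ℝ} (hU : 0 ≤ U)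
    {τ τ' : Fin 2} (hne : τ' ≠ τ) {E : ℝ} {φ : Fock (Orb Λ)}
    (hφ : hamiltonian G t U *ᵥ φ = (E : ℂ) • φ) :
    ∑ z : Λ, (expect (hamiltonian G t U) (annihilation (orb z τ) *ᵥ φ)).re ≤
      (E + Δ * |t|) *
        ∑ z : Λ, (star (annihilation (orb z τ) *ᵥ φ) ⬝ᵥ (annihilation (orb z τ) *ᵥ φ)).re := by
  set c : Λ → Fock (Orb Λ) := fun z => annihilation (orb z τ) *ᵥ φ with hc
  set a : Λ → ℝ := fun z => (star (c z) ⬝ᵥ c z).re with ha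
  set F : Λ → Finset Λ := fun z => Finset.univ.filter fun y => G.Adj z y with hF
  have ha0 : ∀ z, 0 ≤ a z := fun z => re_star_dotProduct_self_nonneg _
  -- `H c_z φ = E c_z φ + t Σ_{y ∼ z} c_y φ - U n_{zτ'} c_z φ`
  have hHc : ∀ z, hamiltonian G t U *ᵥ c z =
      (E : ℂ) • c z + (t : ℂ) • (∑ y ∈ F z, c y) - (U : ℂ) • (numberOp z τ' *ᵥ c z) := by
    intro z
    have h1 : hamiltonian G t U * annihilation (orb z τ) =
        annihilation (orb z τ) * hamiltonian G t U +
          (t : ℂ) • (∑ y ∈ F z, annihilation (orb y τ)) -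
            (U : ℂ) • (numberOp z τ' * annihilation (orb z τ)) := by
      have h0 := hamiltonian_commutator_annihilation G t U z hne
      rw [sub_eq_iff_eq_add] at h0
      rw [h0]
      abel
    show hamiltonian G t U *ᵥ (annihilation (orb z τ) *ᵥ φ) = _
    rw [mulVec_mulVec, h1, sub_mulVec, add_mulVec, smul_mulVec, smul_mulVec, sum_mulVec,
      ← mulVec_mulVec, hφ, mulVec_smul, ← mulVec_mulVec]
  -- the pointwise identity for `Re ⟨c_z φ, H c_z φ⟩`
  have hpt : ∀ z, (expect (hamiltonian G t U) (c z)).re =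
      E * a z + t * ∑ y ∈ F z, (star (c z) ⬝ᵥ c y).re -
        U * (star (annihilation (orb z τ') *ᵥ c z) ⬝ᵥ (annihilation (orb z τ') *ᵥ c z)).re := by
    intro z
    have hn : star (c z) ⬝ᵥ (numberOp z τ' *ᵥ c z) =
        star (annihilation (orb z τ') *ᵥ c z) ⬝ᵥ (annihilation (orb z τ') *ᵥ c z) := by
      rw [← LiebThm1.star_dotProduct_conjTranspose_mul_mulVec, annihilation_conjTranspose]
      rfl
    rw [expect, hHc z, dotProduct_sub, dotProduct_add, dotProduct_smul, dotProduct_smul, dotProduct_smul,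
      dotProduct_sum, hn, Complex.sub_re, Complex.add_re, smul_eq_mul, smul_eq_mul, smul_eq_mul,
      Complex.re_ofReal_mul, Complex.re_ofReal_mul, Complex.re_ofReal_mul, Complex.re_sum]
  -- the hopping part, pointwise
  have hX : ∀ z, t * ∑ y ∈ F z, (star (c z) ⬝ᵥ c y).re ≤
      |t| * ((∑ y ∈ F z, a z) + ∑ y ∈ F z, a y) / 2 := by
    intro z
    calc t * ∑ y ∈ F z, (star (c z) ⬝ᵥ c y).re
        ≤ |t * ∑ y ∈ F z, (star (c z) ⬝ᵥ c y).re| := le_abs_self _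
      _ = |t| * |∑ y ∈ F z, (star (c z) ⬝ᵥ c y).re| := abs_mul _ _
      _ ≤ |t| * ∑ y ∈ F z, |(star (c z) ⬝ᵥ c y).re| :=
          mul_le_mul_of_nonneg_left (Finset.abs_sum_le_sum_abs _ _) (abs_nonneg t)
      _ ≤ |t| * ∑ y ∈ F z, (a z + a y) / 2 := by
          refine mul_le_mul_of_nonneg_left (Finset.sum_le_sum fun y _ => ?_) (abs_nonneg t)
          have := two_mul_abs_re_dot_le (c z) (c y)
          simp only [ha]
          linarith
      _ = |t| * ((∑ y ∈ F z, a z) + ∑ y ∈ F z, a y) / 2 := by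
          rw [← Finset.sum_add_distrib, ← Finset.sum_div, mul_div_assoc]
  -- degree counting
  have hdeg1 : ∑ z, ∑ _y ∈ F z, a z ≤ Δ * ∑ z, a z := by
    rw [Finset.mul_sum]
    refine Finset.sum_le_sum fun z _ => ?_
    rw [Finset.sum_const, nsmul_eq_mul]
    exact mul_le_mul_of_nonneg_right (by exact_mod_cast hΔ z) (ha0 z)
  have hdeg2 : ∑ z, ∑ y ∈ F z, a y ≤ Δ * ∑ y, a y := by
    calc ∑ z, ∑ y ∈ F z, a y
        = ∑ z, ∑ y, if G.Adj z y then a y else 0 := by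
          refine Finset.sum_congr rfl fun z _ => ?_
          rw [hF, Finset.sum_filter]
      _ = ∑ y, ∑ z, if G.Adj z y then a y else 0 := Finset.sum_comm
      _ = ∑ y, ((Finset.univ.filter fun z => G.Adj z y).card : ℝ) * a y := by
          refine Finset.sum_congr rfl fun y _ => ?_
          rw [← Finset.sum_filter, Finset.sum_const, nsmul_eq_mul]
      _ ≤ ∑ y, (Δ : ℝ) * a y := by
          refine Finset.sum_le_sum fun y _ => mul_le_mul_of_nonneg_right ?_ (ha0 y)
          have hsymm : (Finset.univ.filter fun z => G.Adj z y) =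
              Finset.univ.filter fun z => G.Adj y z := by
            refine Finset.filter_congr fun z _ => ?_
            exact G.adj_comm _ _
          rw [hsymm]
          exact_mod_cast hΔ y
      _ = Δ * ∑ y, a y := by rw [Finset.mul_sum]
  -- assemble
  calc ∑ z, (expect (hamiltonian G t U) (c z)).re
      = ∑ z, (E * a z + t * ∑ y ∈ F z, (star (c z) ⬝ᵥ c y).re -
          U * (star (annihilation (orb z τ') *ᵥ c z) ⬝ᵥ (annihilation (orb z τ') *ᵥ c z)).re) :=
        Finset.sum_congr rfl fun z _ => hpt z
    _ ≤ ∑ z, (E * a z + |t| * ((∑ y ∈ F z, a z) + ∑ y ∈ F z, a y) / 2) := by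
        refine Finset.sum_le_sum fun z _ => ?_
        have h1 := hX z
        have h2 : 0 ≤ U * (star (annihilation (orb z τ') *ᵥ c z) ⬝ᵥ
            (annihilation (orb z τ') *ᵥ c z)).re := mul_nonneg hU (re_star_dotProduct_self_nonneg _)
        linarith
    _ = E * ∑ z, a z + |t| * ((∑ z, ∑ _y ∈ F z, a z) + ∑ z, ∑ y ∈ F z, a y) / 2 := by
        rw [Finset.sum_add_distrib, ← Finset.mul_sum, ← Finset.sum_div, ← Finset.mul_sum,
          Finset.sum_add_distrib]
    _ ≤ E * ∑ z, a z + |t| * ((Δ * ∑ z, a z) + Δ * ∑ z, a z) / 2 := by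
        have ht : 0 ≤ |t| := abs_nonneg t
        nlinarith [hdeg1, hdeg2, ht]
    _ = (E + Δ * |t|) * ∑ z, a z := by ring

/-- **One-particle removal**: with the hypotheses of `sum_re_expect_annihilation_le`, if a number
`E'` satisfies the homogeneous variational bound `E' ‖c_{zτ}φ‖² ≤ Re ⟨c_{zτ}φ, H c_{zτ}φ⟩` for every
`z` (e.g. the sector energy of the sector containing the `c_{zτ}φ`) and the `c_{zτ}φ` do not all
vanish, then `E' ≤ E + Δ|t|` (sum over `z`). Tasaki (2020) §2.1; Ruelle, *Statistical Mechanics*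
(1969) §3.4 (the classical analogue). [folklore] -/
theorem le_of_removal_bound {Δ : ℕ}
    (hΔ : ∀ x : Λ, (Finset.univ.filter fun y => G.Adj x y).card ≤ Δ) (t : ℝ) {U : ℝ} (hU : 0 ≤ U)
    {τ τ' : Fin 2} (hne : τ' ≠ τ) {E : ℝ} {φ : Fock (Orb Λ)}
    (hφ : hamiltonian G t U *ᵥ φ = (E : ℂ) • φ) {E' : ℝ}
    (hvar : ∀ z : Λ,
      E' * (star (annihilation (orb z τ) *ᵥ φ) ⬝ᵥ (annihilation (orb z τ) *ᵥ φ)).re ≤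
        (expect (hamiltonian G t U) (annihilation (orb z τ) *ᵥ φ)).re)
    (hpos : 0 < ∑ z : Λ,
      (star (annihilation (orb z τ) *ᵥ φ) ⬝ᵥ (annihilation (orb z τ) *ᵥ φ)).re) :
    E' ≤ E + Δ * |t| := by
  have h1 : E' * ∑ z : Λ,
      (star (annihilation (orb z τ) *ᵥ φ) ⬝ᵥ (annihilation (orb z τ) *ᵥ φ)).re ≤
      ∑ z : Λ, (expect (hamiltonian G t U) (annihilation (orb z τ) *ᵥ φ)).re := by
    rw [Finset.mul_sum]
    exact Finset.sum_le_sum fun z _ => hvar z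
  exact le_of_mul_le_mul_right (h1.trans (sum_re_expect_annihilation_le G hΔ t hU hne hφ)) hpos

end Removal

/-! ### The torus `(ℤ/Lℤ)²`: the two halves of the window -/

section Torus

variable (L : ℕ) [NeZero L]

omit [NeZero L] in
/-- **Upper sector bound** `E(2n+2, 0) ≤ E(2n, 0) + U` for `2n < L²` on the torus of even side:
`η†` maps a ground state `ψ` of the sector `(n, n)` to a nonzero vector of the sector `(n+1, n+1)`
(`‖η†ψ‖² = ‖ηψ‖² + (L² - 2n)‖ψ‖²`) with `H η†ψ = (E + U) η†ψ` (Yang's `[H, η†] = U η†`).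
Yang, PRL 63 (1989) 2144, eqs. (5)–(6). [folklore] -/
theorem minEnergyOn_pairAdded_le (U : ℝ) (hL : Even L) {n : ℕ} (hn : 2 * n < L ^ 2) :
    (hubbardTorus 2 L 1 U).minEnergyOn (szSector (2 * (n + 1)) 0) ≤
      (hubbardTorus 2 L 1 U).minEnergyOn (szSector (2 * n) 0) + U := by
  have hcard : Fintype.card (FermionTorus 2 L) = L ^ 2 := card_fermionTorus 2 L
  have hn0 : n ≤ Fintype.card (FermionTorus 2 L) := by rw [hcard]; omega
  have hn1 : n + 1 ≤ Fintype.card (FermionTorus 2 L) := by rw [hcard]; omega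
  set H := hubbardTorus 2 L 1 U with hH
  have hHG : H = hamiltonian (fermionTorusGraph 2 L) 1 U := rfl
  obtain ⟨⟨ψ, hψS, hψ0, hHψ⟩, -⟩ := szSector_groundState (fermionTorusGraph 2 L) 1 U hn0
  rw [← hHG] at hHψ
  have hψsec : IsInSector n n ψ := (mem_szSector_two_mul_zero_iff n ψ).1 hψS
  have hψN : IsNParticle (2 * n) ψ := ((mem_szSector_iff _ _ _).1 hψS).1
  set E₀ : ℝ := H.minEnergyOn (szSector (2 * n) 0) with hE₀
  set φ : Fock (Orb (FermionTorus 2 L)) := etaRaise torusStagger *ᵥ ψ with hφ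
  -- the sector of `φ`
  have hφsec : IsInSector (n + 1) (n + 1) φ :=
    isInSector_mulVec_of_shifts (shifts_etaRaise _) (by omega) (by omega) hψsec
  -- the eigenvalue equation of `φ`
  have hcomm := hamiltonian_commutator_etaRaise (fermionTorusGraph 2 L) torusStagger
    (fun x y h => torusStagger_eq_neg_of_adj_holds hL h) 1 U
  rw [← hHG] at hcomm
  have hHφ : H *ᵥ φ = ((E₀ + U : ℝ) : ℂ) • φ := by
    have h1 : H * etaRaise torusStagger = (U : ℂ) • etaRaise torusStagger + etaRaise torusStagger * H :=
      (sub_eq_iff_eq_add.1 hcomm)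
    show H *ᵥ (etaRaise torusStagger *ᵥ ψ) = ((E₀ + U : ℝ) : ℂ) • (etaRaise torusStagger *ᵥ ψ)
    rw [mulVec_mulVec, h1, add_mulVec, smul_mulVec, ← mulVec_mulVec, hHψ, mulVec_smul, ← add_smul]
    congr 1
    push_cast
    ring
  -- the norm of `φ`
  have hnormC : star φ ⬝ᵥ φ =
      star (etaLower torusStagger *ᵥ ψ) ⬝ᵥ (etaLower torusStagger *ᵥ ψ) +
        ((Fintype.card (FermionTorus 2 L) : ℂ) - ((2 * n : ℕ) : ℂ)) * (star ψ ⬝ᵥ ψ) := by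
    have h1 : star φ ⬝ᵥ φ = star ψ ⬝ᵥ (etaLower torusStagger *ᵥ (etaRaise torusStagger *ᵥ ψ)) := by
      rw [hφ, mulVec_mulVec, etaLower, LiebThm1.star_dotProduct_conjTranspose_mul_mulVec]
    have h2 : star ψ ⬝ᵥ (etaRaise torusStagger *ᵥ (etaLower torusStagger *ᵥ ψ)) =
        star (etaLower torusStagger *ᵥ ψ) ⬝ᵥ (etaLower torusStagger *ᵥ ψ) := by
      rw [mulVec_mulVec, ← LiebThm1.star_dotProduct_conjTranspose_mul_mulVec, etaLower,
        conjTranspose_conjTranspose]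
    have h3 : star ψ ⬝ᵥ (fun s => ((Fintype.card (FermionTorus 2 L) : ℂ) - s.card) * ψ s) =
        ((Fintype.card (FermionTorus 2 L) : ℂ) - ((2 * n : ℕ) : ℂ)) * (star ψ ⬝ᵥ ψ) := by
      rw [dotProduct, dotProduct, Finset.mul_sum]
      refine Finset.sum_congr rfl fun s _ => ?_
      by_cases hs : s.card = 2 * n
      · rw [Pi.star_apply, hs]
        ring
      · rw [Pi.star_apply, hψN s hs]
        simp
    rw [h1, EtaPairingODLRO.etaLower_mulVec_etaRaise_mulVec, dotProduct_add, h2, h3]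
  have hnorm : (star φ ⬝ᵥ φ).re =
      (star (etaLower torusStagger *ᵥ ψ) ⬝ᵥ (etaLower torusStagger *ᵥ ψ)).re +
        ((L : ℝ) ^ 2 - 2 * n) * (star ψ ⬝ᵥ ψ).re := by
    rw [hnormC, Complex.add_re, hcard]
    congr 1
    have : ((L ^ 2 : ℕ) : ℂ) - ((2 * n : ℕ) : ℂ) = (((L : ℝ) ^ 2 - 2 * n : ℝ) : ℂ) := by
      push_cast
      ring
    rw [this, Complex.re_ofReal_mul]
  have hφpos : 0 < (star φ ⬝ᵥ φ).re := by
    rw [hnorm]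
    have h1 := re_star_dotProduct_self_nonneg (etaLower torusStagger *ᵥ ψ)
    have h2 := re_star_dotProduct_self_pos hψ0
    have h3 : (0 : ℝ) < (L : ℝ) ^ 2 - 2 * n := by
      have : ((2 * n : ℕ) : ℝ) < ((L ^ 2 : ℕ) : ℝ) := by exact_mod_cast hn
      push_cast at this
      linarith
    nlinarith
  -- the variational principle in the sector `(n+1, n+1)`
  have hvar := (szSector_groundState (fermionTorusGraph 2 L) 1 U hn1).2 φ hφsec
  rw [← hHG] at hvar
  have hexp : (expect H φ).re = (E₀ + U) * (star φ ⬝ᵥ φ).re := by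
    rw [Literature.MathematicalPhysics.QuantumLattice.expect, hHφ, dotProduct_smul, smul_eq_mul,
      Complex.re_ofReal_mul]
  rw [hexp] at hvar
  exact le_of_mul_le_mul_right hvar hφpos

/-- **Lower bound** `E(2n, 0) ≤ E(2n+2, 0) + 8` for `n + 1 ≤ L²` and `U ≥ 0`: remove a `↓` electron
from a ground state of the sector `(n+1, n+1)` (`E(n+1, n) ≤ E(2n+2, 0) + 4`) and then an `↑`
electron from a ground state of the sector `(n+1, n)` (`E(2n, 0) ≤ E(n+1, n) + 4`), each time by
`le_of_removal_bound` with `Δ = 4` (`SourceGas.card_filter_fermionTorusGraph_adj_le`), `t = 1`, the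
sector ground states and variational bounds being the tree's `szSector_groundState` /
`upDownSector_groundState`. Folklore (the route's "Euler identity"
`Σ_x c†_{xσ}[H, c_{xσ}] = -T_σ - U D`); Tasaki (2020) §2.1. [folklore] -/
theorem minEnergyOn_pairRemoved_le {U : ℝ} (hU : 0 ≤ U) {n : ℕ} (hn : n + 1 ≤ L ^ 2) :
    (hubbardTorus 2 L 1 U).minEnergyOn (szSector (2 * n) 0) ≤
      (hubbardTorus 2 L 1 U).minEnergyOn (szSector (2 * (n + 1)) 0) + 8 := by
  have hcard : Fintype.card (FermionTorus 2 L) = L ^ 2 := card_fermionTorus 2 L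
  have hn0 : n ≤ Fintype.card (FermionTorus 2 L) := by rw [hcard]; omega
  have hn1 : n + 1 ≤ Fintype.card (FermionTorus 2 L) := by rw [hcard]; omega
  set H := hubbardTorus 2 L 1 U with hH
  have hHG : H = hamiltonian (fermionTorusGraph 2 L) 1 U := rfl
  have hΔ : ∀ x : FermionTorus 2 L,
      (Finset.univ.filter fun y => (fermionTorusGraph 2 L).Adj x y).card ≤ 4 := fun x =>
    (SourceGas.card_filter_fermionTorusGraph_adj_le x).trans (by norm_num)
  have h10 : (1 : Fin 2) ≠ 0 := by decide
  have h01 : (0 : Fin 2) ≠ 1 := by decide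
  -- the two sector ground states: `φ₁` in `(n+1, n+1)`, `φ₂` in `(n+1, n)`
  obtain ⟨⟨φ₁, hφ₁S, hφ₁0, hHφ₁⟩, -⟩ := szSector_groundState (fermionTorusGraph 2 L) 1 U hn1
  have hsec₁ : IsInSector (n + 1) (n + 1) φ₁ := (mem_szSector_two_mul_zero_iff (n + 1) φ₁).1 hφ₁S
  obtain ⟨⟨φ₂, hsec₂, hφ₂0, hHφ₂⟩, hvar₁⟩ :=
    upDownSector_groundState (fermionTorusGraph 2 L) 1 U (a := n + 1) (b := n) hn1 hn0
  have hvar₀ := (szSector_groundState (fermionTorusGraph 2 L) 1 U hn0).2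
  -- step 1: remove a `↓` electron from `φ₁`
  have hpos₁ : 0 < ∑ z : FermionTorus 2 L,
      (star (annihilation (orb z 1) *ᵥ φ₁) ⬝ᵥ (annihilation (orb z 1) *ᵥ φ₁)).re := by
    rw [← Complex.re_sum, sum_norm_annihilation_mulVec, sum_numberOp_down_mulVec hsec₁,
      dotProduct_smul, smul_eq_mul, ← Complex.ofReal_natCast, Complex.re_ofReal_mul]
    have := re_star_dotProduct_self_pos hφ₁0
    positivity
  have h1 := le_of_removal_bound (fermionTorusGraph 2 L) hΔ 1 hU h01 hHφ₁
    (fun z => hvar₁ _ (hsec₁.annihilation_down_mulVec z)) hpos₁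
  -- step 2: remove an `↑` electron from `φ₂`
  have hpos₂ : 0 < ∑ z : FermionTorus 2 L,
      (star (annihilation (orb z 0) *ᵥ φ₂) ⬝ᵥ (annihilation (orb z 0) *ᵥ φ₂)).re := by
    rw [← Complex.re_sum, sum_norm_annihilation_mulVec, sum_numberOp_up_mulVec hsec₂,
      dotProduct_smul, smul_eq_mul, ← Complex.ofReal_natCast, Complex.re_ofReal_mul]
    have := re_star_dotProduct_self_pos hφ₂0
    positivity
  have h2 := le_of_removal_bound (fermionTorusGraph 2 L) hΔ 1 hU h10 hHφ₂
    (fun z => hvar₀ _ (hsec₂.annihilation_up_mulVec z)) hpos₂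
  rw [← hHG] at h1 h2
  simp only [abs_one, mul_one, Nat.cast_ofNat] at h1 h2
  linarith

/-- **The pair chemical-potential window** (route `EnslavedA1g`, item
`stmt-HubbardSuperconductivity-0939`): for `U ≥ 0`, even `L > 2`, even `N` with `N + 2 ≤ L²`,
`0 ≤ U - (E(N+2,0) - E(N,0)) ≤ U + 8` where `E(N,0) = minEnergyOn (hubbardTorus 2 L 1 U) (szSector N 0)`.
Upper sector bound by Yang's `η†` raising (`minEnergyOn_pairAdded_le`), lower bound by two
one-particle removals (`minEnergyOn_pairRemoved_le`). Yang, PRL 63 (1989) 2144; Lieb, PRL 62 (1989)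
1201; Tasaki (2020) §2.1. [folklore] -/
theorem pairChemicalPotentialWindow_proof : PairChemicalPotentialWindow := by
  intro U hU L _ hL _ N hN hNL
  obtain ⟨n, rfl⟩ := hN
  have h2n : n + n = 2 * n := by ring
  rw [h2n] at hNL ⊢
  have h2n2 : 2 * n + 2 = 2 * (n + 1) := by ring
  rw [h2n2]
  have hlt : 2 * n < L ^ 2 := by omega
  have hle : n + 1 ≤ L ^ 2 := by omega
  have hup := minEnergyOn_pairAdded_le L U hL hlt
  have hlow := minEnergyOn_pairRemoved_le L hU hle
  constructor <;> linarith

end Torus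

end Summit.HubbardSuperconductivity.HubbardSuperconductivity.Theorems.EnslavedA1g
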